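import Summits.BirchSwinnertonDyer.BirchSwinnertonDyer.Theorems.PrintCFramBottomClassIndexLawFiveLeEisensteinAnalyticOfPrint
import Literature.NumberTheory.EllipticCurves.IwasawaCharGeneratorMuLambda
import HarnessLib

/-!
# Route `PrintCFram`, crux C2 `BottomClassIndexLawFiveLe` (stmt-BirchSwinnertonDyer-20372), line `eisenstein-resource-bdp-line`
# (registry v5): the REGULAR LOCUS, algebraic half — trivial residual Selmer groups of a residual line force
# `X_(∅,0) ` to have a UNIT characteristic power series (`XAc.HasCharValuationAt … 0`)

Cell `bsd-print-cfram`, LEAD seat `bsd-line-cfram-p1` (generation g5), `--supports stmt-BirchSwinnertonDyer-20372` (helper).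
HONEST FRAMING. Nothing about BSD is proved here and no stub of the line is closed. This file is the algebraic half of the
LEAD g5 observation that ON THE KRIZ–LI (regular) LOCUS the crux needs neither research stub: if at an anticyclotomic
frame `(κ, γ, 𝔭)` some `Γ_K`-stable line `Φ ≤ E_K[p]` with no non-zero `ker κ ⊓ D_𝔭`-fixed vector in `E_K[p]/Φ` has BOTH
residual Selmer groups `R_𝔭^S(K_∞, Φ)`, `R_𝔭^S(K_∞, E_K[p]/Φ)` TRIVIAL, then the (∅,0) dual `X = X_ac^∅(E_K[p^∞])` at `𝔭` is
`Λ`-torsion with `μ(X) = 0` (Greenberg's criterion, tree `isTorsion_of_finite_pTorsion` / `muInvariant_eq_zero_of_finite_pTorsion`),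
`λ(X) = 0` (w2 g3's counted devissage `pow_lambdaInvariant_empty_le_mul_natCard_residualSelmer_of_line`: `p^λ ≤ 1·1`), hence
its characteristic ideal is generated by `p^0 · g₀` with `ord ḡ₀ = 0` (Literature `exists_charIdeal_eq_span_C_pow_mu_mul`), i.e.
by a power series with UNIT constant term: `XAc.HasCharValuationAt … 0` — the input `n = 0` of both IMC sockets of the row
kernels. §1 is generic (any curve over any number field, any odd `p`, any `ℤ_p`-extension); §2 instantiates it on the
CM-ramified class over a Heegner field, where the local clause (L) is k7r's `W(ℚ_p)[p] = 0` + X11b.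
BSD is not proved by any of this; no summit statement is proved by this seat.

References: Castella–Grossi–Lee–Skinner 2022 §3 (Thm. 3.2.1, Props. 14, 17, 18) [CastellaGrossiLeeSkinner2022];
Greenberg–Vatsal 2000 §2 Prop. (2.8) [GreenbergVatsal2000]; Washington §13.2 [Washington1997]; Kriz–Li 2019 p. 3 and Thm. 1.20
[KrizLi2019].
-/

set_option autoImplicit false
-- the summit namespace `Summit.BirchSwinnertonDyer.BirchSwinnertonDyer` repeats the problem name by design (D-0017)
set_option linter.dupNamespace false

noncomputable section

open scoped Classical

namespace Summit.BirchSwinnertonDyer.BirchSwinnertonDyer.Theorems.PrintCFram.RegularLocus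

open WeierstrassCurve NumberField IsDedekindDomain Field PowerSeries IsLocalRing
  Literature.NumberTheory.EllipticCurves Literature.NumberTheory.EllipticCurves.GreenbergSelmer
  Literature.NumberTheory.EllipticCurves.GreenbergVatsal2000
  Literature.NumberTheory.EllipticCurves.ModularForms
  Literature.NumberTheory.EllipticCurves.Rank1Residual
  Literature.NumberTheory.EllipticCurves.Rank1Residual.Typed
  Literature.NumberTheory.EllipticCurves.IwasawaAlgebra
  Literature.NumberTheory.GaloisRepresentations
  Summit.BirchSwinnertonDyer.Rank1Residual
  Summit.BirchSwinnertonDyer.Rank1Residual.X11b Summit.BirchSwinnertonDyer.Rank1Residual.X11b.AcSelmer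
  Summit.BirchSwinnertonDyer.Rank1Residual.X2.ResidualDevissageModules
  Summit.BirchSwinnertonDyer.BirchSwinnertonDyer.Theorems
  Summit.BirchSwinnertonDyer.BirchSwinnertonDyer.Theorems.SchneiderFree
  Summit.BirchSwinnertonDyer.BirchSwinnertonDyer.Theorems.RamifiedSevenEllipticUnits
  Summit.BirchSwinnertonDyer.BirchSwinnertonDyer.Theorems.PrintCFram
  Summit.BirchSwinnertonDyer.BirchSwinnertonDyer.Theorems.PrintCFram.EisensteinResourceBdpLine
  Summit.BirchSwinnertonDyer.BirchSwinnertonDyer.Theorems.PrintCFram.LambdaResidualBound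
  Summit.BirchSwinnertonDyer.BirchSwinnertonDyer.Theorems.UniversalToricDescentStrictPlace
  Summit.BirchSwinnertonDyer.BirchSwinnertonDyer.Theorems.UniversalToricDescentAcDualMuZero
  Summit.BirchSwinnertonDyer.BirchSwinnertonDyer.Theorems.CumulativeHeegnerInclusionAtThreeResidualDevissage

/-! ## §1 Generic: trivial residual Selmer groups of a line ⟹ unit characteristic power series -/

section Generic

universe u

variable {K : Type} [Field K] [NumberField K] (W : WeierstrassCurve K) [W.IsElliptic] (p : ℕ) [hp : Fact p.Prime]
  (κ : ZpExtension K p) (𝔭 : HeightOneSpectrum (𝓞 K)) (γ : absoluteGaloisGroup K) [Fact (κ.IsTopGenerator γ)]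

/-- **A torsion `Λ`-module with `μ = λ = 0` has a characteristic power series with UNIT constant term.** For a finitely
generated torsion `Λ = ℤ_p⟦T⟧`-module `M` with `μ(M) = 0` and `λ(M) = 0`, the characteristic ideal is `(g₀)` for some `g₀`
with `g₀(0) ∈ ℤ_pˣ` (so `g₀(0) ≠ 0` and `ord_p g₀(0) = 0`): the Literature generator `p^{μ} g₀` with `ord ḡ₀ = λ`.
[cite: Washington1997, §13.2 (Thm. 13.12 and the definition of `λ`, `μ`)] -/
theorem exists_charIdeal_eq_span_of_mu_lambda_zero (M : Type*) [AddCommGroup M] [Module (IwasawaAlgebra p) M]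
    [Module.Finite (IwasawaAlgebra p) M] (hM : Module.IsTorsion (IwasawaAlgebra p) M)
    (hμ : muInvariant p M = 0) (hl : lambdaInvariant p M = 0) :
    ∃ g : IwasawaAlgebra p, Module.charIdeal (IwasawaAlgebra p) M = Ideal.span {g} ∧
      PowerSeries.constantCoeff g ≠ 0 ∧ (PowerSeries.constantCoeff g).valuation = 0 := by
  obtain ⟨g₀, hchar, hg0, hord⟩ := exists_charIdeal_eq_span_C_pow_mu_mul (p := p) M hM
  rw [hμ, pow_zero, map_one, one_mul] at hchar
  rw [hl] at hord
  -- `ord ḡ₀ = 0`: the constant term of `ḡ₀` is non-zero, i.e. `g₀(0)` is a unit of `ℤ_p`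
  have hc : PowerSeries.coeff 0 (PowerSeries.map (residue ℤ_[p]) g₀) ≠ 0 := by
    have h := (PowerSeries.order_eq_nat.mp (by exact_mod_cast hord)).1
    exact h
  rw [PowerSeries.coeff_map, PowerSeries.coeff_zero_eq_constantCoeff] at hc
  have hunit : IsUnit (PowerSeries.constantCoeff g₀) := by
    by_contra hnu
    exact hc ((residue_eq_zero_iff _).mpr ((mem_maximalIdeal _).mpr hnu))
  exact ⟨g₀, hchar, hunit.ne_zero, padicInt_valuation_eq_zero_of_isUnit hunit⟩

/-- **Trivial residual Selmer groups of a line devissage ⟹ `XAc.HasCharValuationAt … ∅ … 0`** (generic; CGLS §3 read at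
`#R = 1`). Hypotheses: `p` odd; `𝔭 ∋ p` with `D_𝔭 ⊄ ker κ`; `S ⊇` the bad places prime to `p`; a `Γ_K`-stable `Φ ≤ E[p]` with no
non-zero `ker κ ⊓ D_𝔭`-fixed vector in `E[p]/Φ`; (L) `E[p^∞]^{ker κ ⊓ D_𝔭}` has no `p`-torsion; `#R_𝔭^S(K_∞, Φ) = #R_𝔭^S(K_∞, E[p]/Φ)
= 1`. Then `X_ac^∅(E[p^∞])` at `𝔭` is `Λ`-torsion with a characteristic generator of unit constant term.
[cite: CastellaGrossiLeeSkinner2022, §3 Thm. 3.2.1 and Props. 17–18 (arXiv:2008.02571)] [cite: GreenbergVatsal2000, §2 Prop. (2.8)] -/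
theorem hasCharValuationAt_zero_of_natCard_residualSelmer_eq_one (hp2 : p ≠ 2)
    (h𝔭 : ((p : ℕ) : 𝓞 K) ∈ 𝔭.asIdeal) (h𝔭dec : ¬ (decomp 𝔭 ≤ κ.kerSubgroup))
    {S : Set (HeightOneSpectrum (𝓞 K))}
    (hSgood : ∀ v : HeightOneSpectrum (𝓞 K), v ∉ S → ((p : ℕ) : 𝓞 K) ∉ v.asIdeal → W.HasGoodReductionAt v)
    (Φ : X2.ResidualDevissageModules.StableSubgroup (absoluteGaloisGroup K) (W.geomTorsion (p : ℤ)))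
    (hfix : ∀ y : Φ.Quot, (∀ g : ↥(κ.kerSubgroup ⊓ decomp 𝔭), g • y = y) → y = 0)
    (hL : ∀ m : W.geomPrimaryTorsion p, (∀ σ ∈ κ.kerSubgroup ⊓ decomp 𝔭, σ • m = m) → p • m = 0 → m = 0)
    (h1 : Nat.card (datumStrictSelmer κ.kerSubgroup Φ.Sub p (AcSelmer.bdpData Φ.Sub p 𝔭) S) = 1)
    (h2 : Nat.card (datumStrictSelmer κ.kerSubgroup Φ.Quot p (AcSelmer.bdpData Φ.Quot p 𝔭) S) = 1) :
    XAc.HasCharValuationAt W p κ 𝔭 ∅ γ 0 := by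
  have hpr : p.Prime := Fact.out
  haveI : Finite (datumStrictSelmer κ.kerSubgroup Φ.Sub p (AcSelmer.bdpData Φ.Sub p 𝔭) S) :=
    Nat.finite_of_card_ne_zero (by rw [h1]; exact one_ne_zero)
  haveI : Finite (datumStrictSelmer κ.kerSubgroup Φ.Quot p (AcSelmer.bdpData Φ.Quot p 𝔭) S) :=
    Nat.finite_of_card_ne_zero (by rw [h2]; exact one_ne_zero)
  have hΦ : (datumStrictSelmer κ.kerSubgroup Φ.Sub p (AcSelmer.bdpData Φ.Sub p 𝔭) S :
      Set (subgroupH1 κ.kerSubgroup Φ.Sub)).Finite := Set.toFinite _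
  have hΨ : (datumStrictSelmer κ.kerSubgroup Φ.Quot p (AcSelmer.bdpData Φ.Quot p 𝔭) S :
      Set (subgroupH1 κ.kerSubgroup Φ.Quot)).Finite := Set.toFinite _
  -- `Sel^∅[p]` finite ⟹ torsion, `μ = 0`, finitely generated
  have hfin0 := finite_selmerAc_empty_pTorsion_of_line_devissage W κ h𝔭 h𝔭dec hSgood Φ hfix hΦ hΨ
  have htor := isTorsion_of_finite_pTorsion W p κ 𝔭 ∅ γ Set.finite_empty hfin0
  have hμ := muInvariant_eq_zero_of_finite_pTorsion W p κ 𝔭 ∅ γ Set.finite_empty hfin0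
  haveI := XAc.module_finite κ 𝔭 ∅ γ Set.finite_empty (W := W)
  -- `λ = 0` from `p^λ ≤ #R(Φ)·#R(E[p]/Φ) = 1`
  have hlam := pow_lambdaInvariant_empty_le_mul_natCard_residualSelmer_of_line W p κ 𝔭 γ hp2 h𝔭 h𝔭dec hSgood Φ hfix
    hL hΦ hΨ
  rw [h1, h2, mul_one] at hlam
  have hl : lambdaInvariant p (XAc W p κ 𝔭 ∅ γ) = 0 := by
    by_contra hne0
    have h' : p ^ 1 ≤ p ^ lambdaInvariant p (XAc W p κ 𝔭 ∅ γ) :=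
      Nat.pow_le_pow_right hpr.pos (Nat.one_le_iff_ne_zero.mpr hne0)
    have := h'.trans hlam
    rw [pow_one] at this
    exact absurd this (by have := hpr.two_le; omega)
  obtain ⟨g, hg, hg0, hgv⟩ := exists_charIdeal_eq_span_of_mu_lambda_zero p (XAc W p κ 𝔭 ∅ γ) htor hμ hl
  exact ⟨htor, g, hg, hg0, hgv⟩

end Generic

/-! ## §2 On the CM-ramified class over a Heegner field: the regularity hypothesis is about the residual line only -/

section Class

variable {p : ℕ} [Fact p.Prime]

/-- **Regular frame ⟹ unit characteristic power series, on the CM-ramified rows.** For `W/ℚ` globally minimal with CM,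
`p ≥ 5` CM-ramified, a Heegner field `K` of `N_W` (so `p ∣ N_W` splits in `K`), a `ℤ_p`-extension `κ` of `K` with a
topological generator `γ`, and a prime `𝔭 ∋ p` of `K`: IF some `Γ_K`-stable `Φ ≤ W_K[p]` with no non-zero
`ker κ ⊓ D_𝔭`-fixed vector in `W_K[p]/Φ` has TRIVIAL residual Selmer groups `R_𝔭^S(K_∞, Φ)`, `R_𝔭^S(K_∞, W_K[p]/Φ)` at the bad
set `S` (hypothesis `hreg` — on the class such a `Φ` is the kernel of the certified rational `p`-isogeny, LEAD g4
`RationalPIsogeny`/`IsogenyLineData`, and the triviality is the «relative `p`-class numbers» / Bernoulli-unit condition of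
Kriz–Li read in the tower via CGLS Prop. 14), THEN `XAc.HasCharValuationAt (W.baseChange K) p κ 𝔭 ∅ γ 0`. The local clause (L)
is discharged by k7r's `W(ℚ_p)[p] = 0` and X11b at the degree-one `𝔭`; `D_𝔭 ⊄ ker κ` by `K` imaginary quadratic.
[cite: CastellaGrossiLeeSkinner2022, §3 Thm. 3.2.1 and Props. 14, 17, 18 (arXiv:2008.02571)] [cite: KrizLi2019, p. 3 and Thm. 1.20] -/
theorem hasCharValuationAt_zero_cmRamified_of_regular
    (W : WeierstrassCurve ℚ) [W.IsElliptic] [W.IsGloballyMinimal] (hCM : W.HasCM) (hram : CMRamified W p) (h5 : 5 ≤ p)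
    {N : ℕ} [NeZero N] {K : Type} [Field K] [NumberField K]
    (hN : W.conductorNorm ℤ = N) (hK : IsImaginaryQuadratic K) (hHN : SatisfiesHeegnerHypothesis N K)
    (κ : ZpExtension K p) (γ : Field.absoluteGaloisGroup K) [Fact (κ.IsTopGenerator γ)]
    (𝔭 : HeightOneSpectrum (𝓞 K)) (h𝔭 : ((p : ℕ) : 𝓞 K) ∈ 𝔭.asIdeal)
    (hreg : ∃ Φ : X2.ResidualDevissageModules.StableSubgroup (absoluteGaloisGroup K) ((W.baseChange K).geomTorsion (p : ℤ)),
      (∀ y : Φ.Quot, (∀ g : ↥(κ.kerSubgroup ⊓ decomp 𝔭), g • y = y) → y = 0) ∧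
      Nat.card (datumStrictSelmer κ.kerSubgroup Φ.Sub p (AcSelmer.bdpData Φ.Sub p 𝔭)
          {v : HeightOneSpectrum (𝓞 K) | ¬ (W.baseChange K).HasGoodReductionAt v ∧ ((p : ℕ) : 𝓞 K) ∉ v.asIdeal}) = 1 ∧
      Nat.card (datumStrictSelmer κ.kerSubgroup Φ.Quot p (AcSelmer.bdpData Φ.Quot p 𝔭)
          {v : HeightOneSpectrum (𝓞 K) | ¬ (W.baseChange K).HasGoodReductionAt v ∧ ((p : ℕ) : 𝓞 K) ∉ v.asIdeal}) = 1) :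
    XAc.HasCharValuationAt (W.baseChange K) p κ 𝔭 ∅ γ 0 := by
  haveI hEK : (W.baseChange K).IsElliptic := inferInstanceAs (W.map (algebraMap ℚ K)).IsElliptic
  have hp2 : p ≠ 2 := by omega
  have hadd : Addv W p := addv_of_cmRamified W hCM hram h5
  have hpN : p ∣ N := by
    rw [← hN]; exact (W.dvd_conductorNorm_iff_not_hasGoodReductionAtPrime p).mpr hadd.1
  obtain ⟨he, hf⟩ := degreeOne_of_dvd_of_heegner hK hHN hpN h𝔭
  have hW := prime_nsmul_eq_zero_padic_of_hasCM_of_cmRamified W p hCM h5 hram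
  -- (L) at `𝔭`
  have hbot := SchneiderFreeAdditiveX3.fixedPoints_decomp_inf_kerSubgroup_eq_bot_of_noPTorsionPadic W p hW κ 𝔭 h𝔭 he hf
  have hL : ∀ m : (W.baseChange K).geomPrimaryTorsion p,
      (∀ σ ∈ κ.kerSubgroup ⊓ decomp 𝔭, σ • m = m) → p • m = 0 → m = 0 := by
    intro m hm _
    have hmem : m ∈ FixedPoints.addSubgroup ↥(decomp 𝔭 ⊓ κ.kerSubgroup) ((W.baseChange K).geomPrimaryTorsion p) :=
      (FixedPoints.mem_addSubgroup _ _ m).mpr fun d ↦ hm d (by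
        obtain ⟨hd1, hd2⟩ := Subgroup.mem_inf.mp d.2
        exact Subgroup.mem_inf.mpr ⟨hd2, hd1⟩)
    rw [hbot] at hmem
    exact (AddSubgroup.mem_bot).mp hmem
  have h𝔭dec : ¬ (decomp 𝔭 ≤ κ.kerSubgroup) :=
    ZpExtension.not_decomp_le_kerSubgroup_of_isImaginaryQuadratic hK κ (by exact_mod_cast h𝔭)
  obtain ⟨Φ, hfix, h1, h2⟩ := hreg
  exact hasCharValuationAt_zero_of_natCard_residualSelmer_eq_one (W.baseChange K) p κ 𝔭 γ hp2 h𝔭 h𝔭dec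
    (fun v hv hpv ↦ by by_contra hbad; exact hv ⟨hbad, hpv⟩) Φ hfix hL h1 h2

end Class

end Summit.BirchSwinnertonDyer.BirchSwinnertonDyer.Theorems.PrintCFram.RegularLocus

end
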